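import Summits.Ventures.HSemireg.MethodInstanceG6ThetaSecantReachCertificates
import Mathlib.NumberTheory.LegendreSymbol.QuadraticReciprocity
import HarnessLib

/-!
# Venture HSemireg — YES-certificates for the reach of the g = 6 theta-secant method instance: `ℚ(√-d)` is reached iff some `b·v² − a·u² = 2`
# with `a·b = d`; the type `(a, b)` is an invariant of `d`; primes `p ≡ 3, 7 (mod 8)`; the `d < 400` table closed by certificates

HONEST FRAMING. Lean index of the computation cell `pub-hsemireg` (seat p8, «Sunday typer § g = 6»; sequel of
`MethodInstanceG6ThetaSecantReachCertificates.lean`). ELEMENTARY NUMBER THEORY only (the `+2` half of the classical 2-descent on `x² − d·y² = 1`);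
no variety, sheaf or `Ext` group is constructed and no Weil-class statement is made in this file. Nothing here says HC, HC_CM or HC_AV is proved;
the reach concerns SPLIT sixfold components (method instances; the verdict's deciding rows stay «NO-in-families-tried», candidates 0).

WHAT IT ADDS. The predecessor decides the NO side of «`ℚ(√-d)` is reached by some theta-secant parameter `m`» (`∃ m` even, `m² = d·k² + 1`) by a finite
certificate `b·v² − a·u² = 1`, `a·b = d`, `1 < b`, but the YES side only by a Pell witness `(m, k)` (up to 17 digits for `d < 400`), and for the one row
`d = 399 = 3·7·19` no symbol criterion of the sequel files speaks («witness only», `p8/REACH-TABLE-400-p8g4.md`). Here: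
* §1 THE `+2` DESCENT: an EVEN `m` with `m² − d·k² = 1` splits `(m − 1)(m + 1) = d·k²` (coprime odd factors) as `m − 1 = a·u²`, `m + 1 = b·v²`,
  `a·b = d` — a YES-CERTIFICATE `b·v² − a·u² = 2` (`pell_plusTwoCertificate_of_even`, no fundamental solution used); conversely a certificate gives
  the witness `m = a·u² + 1`, `k = u·v` (`thetaSecant_reach_of_plusTwoCertificate`; `u, v` are odd, `plusTwoCertificate_odd`). So for every odd `d`:
  REACH ⟺ YES-CERTIFICATE (`thetaSecant_reach_iff_plusTwoCertificate`), and for odd non-square `d` EXACTLY ONE of «`b·v² − a·u² = 1`, `1 < b`» /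
  «`b·v² − a·u² = 2`» is solvable with `a·b = d` (`thetaSecant_plusOne_xor_plusTwo`; Legendre's theorem on `a·x² − b·y² = ±1, ±2` at `d ≡ 3 (mod 4)`).
* §2 THE TYPE IS AN INVARIANT (`thetaSecant_plusTwoCertificate_unique`): two YES-certificates of one `d` have the same `(a, b)` — every even-`x`
  solution is an odd power of the fundamental one (predecessor §3), `x_n ≡ x₁ⁿ (mod d)` (`pell_dvd_x_pow_sub`), so `a ∣ x − 1`, `b ∣ x + 1` persist
  (`pell_type_dvd_of_even_x`), and divisors of the coprime pair `x ∓ 1` with product `d` determine each other (`plusTwoType_eq_of_dvd`).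
* §3 PRIMES: for an odd prime `p` the type is `(1, p)` (`u² ≡ -2`) or `(p, 1)` (`v² ≡ 2 (mod p)`); reach forces `p ≡ 3 (mod 4)` and the quadratic
  characters of `∓2` leave `p ≡ 3 (mod 8)` ↦ `(1, p)`, `p ≡ 7 (mod 8)` ↦ `(p, 1)` (`pell_plusTwo_prime_type`). As every prime `p ≡ 3 (mod 4)` IS reached
  (predecessor `thetaSecant_reaches_prime`), with no datum: for primes `p ≡ 3 (mod 4)`, `v² − p·u² = 2` is solvable iff `p ≡ 7 (mod 8)`, `p·v² − u² = 2`
  iff `p ≡ 3 (mod 8)` (`pell_plusTwo_solvable_iff_seven_mod_eight`, `pell_minusTwo_solvable_iff_three_mod_eight`).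
* §4 THE `d < 400` TABLE CLOSED BY CERTIFICATES: the 28 composite YES rows carry YES-certificates with `max(u, v) ≤ 2709` (`thetaSecant_yesCertificate_table`,
  `thetaSecant_yesList_400_by_certificate`), `d = 399` being `21·1² − 19·1² = 2` with `(19, 21)` its only type (`thetaSecant_reaches_399_by_certificate`):
  all 82 rows are now decided by a theorem (40 primes) or a certificate of at most 4 digits (28 YES by `+2`, 14 NO by `+1`).
Source of the sentence: `step0/THETA-SECANT-p1.md` v2.6 §1 «COVERAGE (Pell)»; census `target-g6/CENSUS.md` row D-2 REACH cell. 0 `def`, 0 `sorry`,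
0 named fact.
-/


noncomputable section

open CategoryTheory AlgebraicGeometry
open Literature.AlgebraicGeometry.Motives Literature.AlgebraicGeometry.HodgeTheory
open Literature.AlgebraicGeometry.ModuliOfAbelianVarieties Literature.AlgebraicGeometry.Deligne1982
open Literature.AlgebraicGeometry.KTheory
open Literature.AlgebraicTopology.SingularHomology

namespace Summit.Ventures.HSemireg

section PellYesDescent

open Pell

/-! ## §1 The `+2` descent: even `m` ⟺ a YES-certificate `b·v² − a·u² = 2`, `a·b = d` -/

/-- **YES-DESCENT.** For `d > 0`: an EVEN `m > 0` with `m² − d·k² = 1` yields `a·b = d`, `0 < a`, `0 < b`, `m = a·u² + 1` and `b·v² − a·u² = 2`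
(`m − 1 = a·u²`, `m + 1 = b·v²`: the odd numbers `m ∓ 1` are coprime with product `d·k²`; `a = gcd(m − 1, d)`, `b = d/a ∣ m + 1`, and the
cofactors are coprime with square product, hence squares). No fundamental solution and no minimality is used. [bookkeeping] -/
theorem pell_plusTwoCertificate_of_even {d : ℤ} (hd : 0 < d) {m k : ℤ} (hm : Even m) (hm0 : 0 < m) (hmk : m ^ 2 - d * k ^ 2 = 1) :
    ∃ a b u v : ℤ, a * b = d ∧ 0 < a ∧ 0 < b ∧ m = a * u ^ 2 + 1 ∧ b * v ^ 2 - a * u ^ 2 = 2 := by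
  have hd0 : d ≠ 0 := hd.ne'
  obtain ⟨s, hs⟩ := hm
  have hX0 : 0 < m - 1 := by omega
  have key : (m - 1) * (m + 1) = d * k ^ 2 := by linear_combination hmk
  obtain ⟨g, X', d', hg0, hcop, hX', hd'⟩ := Int.exists_gcd_one' (Int.gcd_pos_of_ne_zero_right (m - 1) hd0)
  have hg0' : (0 : ℤ) < g := by exact_mod_cast hg0
  have hcop' : IsCoprime X' d' := Int.isCoprime_iff_gcd_eq_one.2 hcop
  have hd'0 : 0 < d' := by
    have : 0 < d' * (g : ℤ) := by rw [← hd']; exact hd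
    by_contra hle; push Not at hle; nlinarith
  have hX'0 : 0 < X' := by
    have : 0 < X' * (g : ℤ) := by rw [← hX']; exact hX0
    by_contra hle; push Not at hle; nlinarith
  have key' : X' * (m + 1) = d' * k ^ 2 := by
    refine mul_left_cancel₀ hg0'.ne' ?_
    calc (g : ℤ) * (X' * (m + 1)) = (m - 1) * (m + 1) := by rw [hX']; ring
      _ = g * (d' * k ^ 2) := by rw [key, hd']; ring
  obtain ⟨t, ht⟩ : d' ∣ m + 1 := hcop'.symm.dvd_of_dvd_mul_left ⟨k ^ 2, key'⟩
  have hprod : X' * t = k ^ 2 := by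
    have e : d' * (X' * t) = d' * k ^ 2 := by rw [← key', ht]; ring
    exact mul_left_cancel₀ hd'0.ne' e
  have hcopXt : IsCoprime X' t := by
    have h0 : IsCoprime (X' * (g : ℤ)) (d' * t) := by rw [← hX', ← ht]; exact ⟨s, 1 - s, by linear_combination hs⟩
    exact h0.of_mul_left_left.of_mul_right_right
  obtain ⟨u, hu⟩ := Int.sq_of_isCoprime hcopXt hprod
  obtain ⟨v, hv⟩ := Int.sq_of_isCoprime hcopXt.symm (by rw [mul_comm]; exact hprod)
  have hXu : X' = u ^ 2 := hu.elim id fun hu ↦ by nlinarith [sq_nonneg u]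
  have ht0 : 0 < t := by
    have : 0 < d' * t := by rw [← ht]; omega
    by_contra hle; push Not at hle; nlinarith
  have htv : t = v ^ 2 := hv.elim id fun hv ↦ by nlinarith [sq_nonneg v]
  refine ⟨g, d', u, v, by rw [hd', mul_comm], hg0', hd'0, ?_, ?_⟩
  · linear_combination hX' + (g : ℤ) * hXu
  · rw [← htv, ← hXu]
    linear_combination hX' - ht

/-- **YES-CERTIFICATE ⟸ REACH (the cell's ℕ-currency).** An even `m` with `m² = d·k² + 1` yields `a·b = d`, `b·v² = a·u² + 2` with `m = a·u² + 1`
(the certificate has about half the digits of the witness; `d ≡ 3 (mod 4)` is automatic, `mod_four_eq_three_of_even_of_pell`). [bookkeeping] -/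
theorem thetaSecant_plusTwoCertificate_of_reach {d m k : ℕ} (hm : Even m) (hmk : m ^ 2 = d * k ^ 2 + 1) :
    ∃ a b u v : ℕ, a * b = d ∧ b * v ^ 2 = a * u ^ 2 + 2 ∧ m = a * u ^ 2 + 1 := by
  have hd4 := (mod_four_eq_three_of_even_of_pell hm hmk).1
  have hd0 : (0 : ℤ) < d := by exact_mod_cast (show 0 < d by omega)
  have hm0 : (0 : ℤ) < m := by exact_mod_cast Nat.pos_of_ne_zero (by rintro rfl; simp at hmk)
  obtain ⟨a, b, u, v, hab, ha, hb, hmu, hcert⟩ :=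
    pell_plusTwoCertificate_of_even hd0 ((Int.even_coe_nat m).2 hm) hm0 (pell_prop_of_nat hmk)
  refine ⟨a.natAbs, b.natAbs, u.natAbs, v.natAbs, ?_, ?_, ?_⟩
  · have : ((a.natAbs * b.natAbs : ℕ) : ℤ) = (d : ℤ) := by push_cast; rw [abs_of_pos ha, abs_of_pos hb, hab]
    exact_mod_cast this
  · have : ((b.natAbs * v.natAbs ^ 2 : ℕ) : ℤ) = ((a.natAbs * u.natAbs ^ 2 + 2 : ℕ) : ℤ) := by
      push_cast; rw [abs_of_pos ha, abs_of_pos hb, sq_abs, sq_abs]; linarith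
    exact_mod_cast this
  · have : (m : ℤ) = ((a.natAbs * u.natAbs ^ 2 + 1 : ℕ) : ℤ) := by push_cast; rw [abs_of_pos ha, sq_abs]; exact hmu
    exact_mod_cast this

/-- **Parity of a YES-certificate**: for odd `d = a·b`, `b·v² = a·u² + 2` forces `u` and `v` ODD (residues mod 4). [bookkeeping] -/
theorem plusTwoCertificate_odd {d a b u v : ℕ} (hd : Odd d) (hab : a * b = d) (hcert : b * v ^ 2 = a * u ^ 2 + 2) : Odd u ∧ Odd v := by
  subst hab
  obtain ⟨ha, hb⟩ := Nat.odd_mul.1 hd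
  have hz : (b : ZMod 4) * (v : ZMod 4) ^ 2 = (a : ZMod 4) * (u : ZMod 4) ^ 2 + 2 := by exact_mod_cast congrArg (Nat.cast : ℕ → ZMod 4) hcert
  rw [← ZMod.natCast_mod a 4, ← ZMod.natCast_mod b 4, ← ZMod.natCast_mod u 4, ← ZMod.natCast_mod v 4] at hz
  have ha4 : a % 4 = 1 ∨ a % 4 = 3 := by have := Nat.odd_iff.1 ha; omega
  have hb4 : b % 4 = 1 ∨ b % 4 = 3 := by have := Nat.odd_iff.1 hb; omega
  have hu4 := Nat.mod_lt u (by norm_num : 0 < 4); have hv4 := Nat.mod_lt v (by norm_num : 0 < 4)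
  rw [Nat.odd_iff, Nat.odd_iff, show u % 2 = u % 4 % 2 by omega, show v % 2 = v % 4 % 2 by omega]
  revert hz
  generalize u % 4 = u' at hu4 ⊢
  generalize v % 4 = v' at hv4 ⊢
  rcases ha4 with h | h <;> rw [h] <;> rcases hb4 with h' | h' <;> rw [h'] <;>
    interval_cases u' <;> interval_cases v' <;> decide

/-- The witness identity of a YES-certificate: `b·v² = a·u² + 2` ⟹ `(a·u² + 1)² = a·b·(u·v)² + 1`. [bookkeeping] -/
theorem plusTwoCertificate_sq {a b u v : ℕ} (hcert : b * v ^ 2 = a * u ^ 2 + 2) : (a * u ^ 2 + 1) ^ 2 = a * b * (u * v) ^ 2 + 1 :=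
  calc (a * u ^ 2 + 1) ^ 2 = a * u ^ 2 * (a * u ^ 2 + 2) + 1 := by ring
    _ = a * u ^ 2 * (b * v ^ 2) + 1 := by rw [hcert]
    _ = a * b * (u * v) ^ 2 + 1 := by ring

/-- **REACH ⟸ YES-CERTIFICATE.** For odd `d`: `a·b = d`, `b·v² = a·u² + 2` give the EVEN `m = a·u² + 1` and ODD `k = u·v` with `m² = d·k² + 1`
— a theta-secant parameter `m` reaching `ℚ(√-d)`. [bookkeeping] -/
theorem thetaSecant_reach_of_plusTwoCertificate {d a b u v : ℕ} (hd : Odd d) (hab : a * b = d) (hcert : b * v ^ 2 = a * u ^ 2 + 2) :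
    ∃ m k : ℕ, Even m ∧ Odd k ∧ m ^ 2 = d * k ^ 2 + 1 := by
  obtain ⟨hu, hv⟩ := plusTwoCertificate_odd hd hab hcert
  have hab_odd : Odd (a * b) := by rw [hab]; exact hd
  have ha : Odd a := (Nat.odd_mul.1 hab_odd).1
  refine ⟨a * u ^ 2 + 1, u * v, (ha.mul hu.pow).add_one, hu.mul hv, ?_⟩
  rw [← hab]
  exact plusTwoCertificate_sq hcert

/-- **REACH ⟺ YES-CERTIFICATE, for every odd `d`** (no side condition: both sides fail for odd squares and for `d ≡ 1 (mod 4)`). [bookkeeping] -/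
theorem thetaSecant_reach_iff_plusTwoCertificate {d : ℕ} (hd : Odd d) :
    (∃ m k : ℕ, Even m ∧ m ^ 2 = d * k ^ 2 + 1) ↔ ∃ a b u v : ℕ, a * b = d ∧ b * v ^ 2 = a * u ^ 2 + 2 := by
  refine ⟨fun ⟨m, k, hm, hmk⟩ ↦ ?_, fun ⟨a, b, u, v, hab, hcert⟩ ↦ ?_⟩
  · obtain ⟨a, b, u, v, hab, hcert, -⟩ := thetaSecant_plusTwoCertificate_of_reach hm hmk; exact ⟨a, b, u, v, hab, hcert⟩
  · obtain ⟨m, k, hm, -, hmk⟩ := thetaSecant_reach_of_plusTwoCertificate hd hab hcert; exact ⟨m, k, hm, hmk⟩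

/-- **LEGENDRE'S DICHOTOMY for odd non-square `d`**: EXACTLY ONE of «some `b·v² − a·u² = 1` with `a·b = d`, `1 < b`» (NO-certificate) and
«some `b·v² − a·u² = 2` with `a·b = d`» (YES-certificate) holds — the predecessor's `thetaSecant_reach_iff_no_certificate` read through §1
(inside the `+2` family the type is unique as well: §2). [bookkeeping] -/
theorem thetaSecant_plusOne_xor_plusTwo {d : ℕ} (hd : Odd d) (hsq : ¬ IsSquare d) :
    Xor (∃ a b u v : ℕ, a * b = d ∧ 1 < b ∧ b * v ^ 2 = a * u ^ 2 + 1) (∃ a b u v : ℕ, a * b = d ∧ b * v ^ 2 = a * u ^ 2 + 2) := by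
  rw [← thetaSecant_reach_iff_plusTwoCertificate hd, thetaSecant_reach_iff_no_certificate hd hsq]
  by_cases h : ∃ a b u v : ℕ, a * b = d ∧ 1 < b ∧ b * v ^ 2 = a * u ^ 2 + 1
  · exact Or.inl ⟨h, fun hn ↦ hn h⟩
  · exact Or.inr ⟨h, h⟩

/-! ## §2 The type `(a, b)` of a YES-certificate is an invariant of `d` -/

/-- `x`-coordinates along powers reduce to powers: `d ∣ (aⁿ).x − (a.x)ⁿ` (every other term of the binomial expansion carries a factor `d`).
[bookkeeping] -/
theorem pell_dvd_x_pow_sub {d : ℤ} (a : Solution₁ d) (n : ℕ) : d ∣ (a ^ n).x - a.x ^ n := by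
  induction n with
  | zero => simp [Solution₁.x_one]
  | succ n ih =>
    obtain ⟨c, hc⟩ := ih
    refine ⟨a.x * c + (a ^ n).y * a.y, ?_⟩
    rw [pow_succ, Solution₁.x_mul, pow_succ]
    linear_combination a.x * hc

/-- Integer powers: `d ∣ (aⁿ).x − (a.x)^|n|` (`a⁻ⁿ` has the same `x` as `aⁿ`). [bookkeeping] -/
theorem pell_dvd_x_zpow_sub {d : ℤ} (a : Solution₁ d) (n : ℤ) : d ∣ (a ^ n).x - a.x ^ n.natAbs := by
  cases n with
  | ofNat k =>
    rw [Int.ofNat_eq_natCast, zpow_natCast, Int.natAbs_natCast]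
    exact pell_dvd_x_pow_sub a k
  | negSucc k =>
    rw [zpow_negSucc, Solution₁.x_inv, Int.natAbs_negSucc]
    exact pell_dvd_x_pow_sub a (k + 1)

/-- **Reference divisibility along the even-`x` solutions.** For odd `d` with fundamental solution `a₁` and `x₁ = a₀·u₀² + 1`, `b₀·v₀² − a₀·u₀² = 2`,
`a₀·b₀ = d` (a YES-certificate of `x₁` itself): every solution with EVEN POSITIVE `x` has `a₀ ∣ x − 1` and `b₀ ∣ x + 1` — it is `a₁ⁿ` with
`n` odd (predecessor `pell_even_x_iff_odd_exponent`), `x ≡ x₁^|n| (mod d)`, and `x₁ ≡ 1 (mod a₀)`, `x₁ ≡ -1 (mod b₀)`. [bookkeeping] -/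
theorem pell_type_dvd_of_even_x {d : ℤ} (hd : Odd d) {a₁ : Solution₁ d} (h : IsFundamental a₁) {a₀ b₀ u₀ v₀ : ℤ} (hab₀ : a₀ * b₀ = d)
    (hx₁ : a₁.x = a₀ * u₀ ^ 2 + 1) (hc₀ : b₀ * v₀ ^ 2 - a₀ * u₀ ^ 2 = 2) (a : Solution₁ d) (ha : Even a.x) (hpos : 0 < a.x) :
    a₀ ∣ a.x - 1 ∧ b₀ ∣ a.x + 1 := by
  have hx₁even : Even a₁.x := (pell_exists_even_x_iff_isFundamental hd h).1 ⟨a, ha⟩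
  obtain ⟨n, hn, han⟩ := (pell_even_x_iff_odd_exponent hd h hx₁even a).1 ha
  have ha_eq : a = a₁ ^ n := by
    rcases han with han | han
    · exact han
    · exfalso
      have h1 : 0 < (a₁ ^ n).x := Solution₁.x_zpow_pos (by linarith [h.1]) n
      rw [han, Solution₁.x_neg] at hpos
      linarith
  have hdvd : d ∣ a.x - a₁.x ^ n.natAbs := by rw [ha_eq]; exact pell_dvd_x_zpow_sub a₁ n
  have hNodd : Odd n.natAbs := Int.natAbs_odd.2 hn
  have ha₀d : a₀ ∣ d := ⟨b₀, hab₀.symm⟩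
  have hb₀d : b₀ ∣ d := ⟨a₀, by rw [← hab₀, mul_comm]⟩
  have h1 : a₁.x ≡ 1 [ZMOD a₀] := Int.modEq_iff_dvd.2 ⟨-(u₀ ^ 2), by rw [hx₁]; ring⟩
  have h2 : a₁.x ≡ -1 [ZMOD b₀] := Int.modEq_iff_dvd.2 ⟨-(v₀ ^ 2), by linear_combination (-1 : ℤ) * hx₁ + hc₀⟩
  have h1n : a₁.x ^ n.natAbs ≡ 1 [ZMOD a₀] := by simpa using h1.pow n.natAbs
  have h2n : a₁.x ^ n.natAbs ≡ -1 [ZMOD b₀] := by simpa [hNodd.neg_one_pow] using h2.pow n.natAbs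
  constructor
  · have e := dvd_add (dvd_trans ha₀d hdvd) (Int.ModEq.dvd h1n.symm)
    rwa [sub_add_sub_cancel] at e
  · have e := dvd_add (dvd_trans hb₀d hdvd) (Int.ModEq.dvd h2n.symm)
    rwa [sub_add_sub_cancel, sub_neg_eq_add] at e

/-- **Divisors of the coprime pair `N`, `N + 2` with the right products determine each other**: if `N = a·u²` is odd, `b·v² = N + 2`,
`a₀·b₀ = a·b`, `a₀ ∣ N` and `b₀ ∣ N + 2`, then `a = a₀` (`gcd(a, b₀) = gcd(a₀, b) = 1`, `a ∣ a₀·b₀`, `a₀ ∣ a·b`). Pure `gcd` bookkeeping.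
[bookkeeping] -/
theorem plusTwoType_eq_of_dvd {a b u v a₀ b₀ : ℕ} (hodd : Odd (a * u ^ 2)) (hcert : b * v ^ 2 = a * u ^ 2 + 2) (h₀ : a₀ * b₀ = a * b)
    (ha₀ : a₀ ∣ a * u ^ 2) (hb₀ : b₀ ∣ a * u ^ 2 + 2) : a = a₀ := by
  have hcop : Nat.Coprime (a * u ^ 2) (a * u ^ 2 + 2) :=
    Nat.coprime_self_add_right.2 ((Nat.prime_two.coprime_iff_not_dvd.2 (Nat.two_dvd_ne_zero.2 (Nat.odd_iff.1 hodd))).symm)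
  have haN : a ∣ a * u ^ 2 := Dvd.intro _ rfl
  have hbN : b ∣ a * u ^ 2 + 2 := ⟨v ^ 2, hcert.symm⟩
  have h1 : Nat.Coprime a b₀ := (hcop.coprime_dvd_left haN).coprime_dvd_right hb₀
  have h2 : Nat.Coprime a₀ b := (hcop.coprime_dvd_left ha₀).coprime_dvd_right hbN
  have e1 : a ∣ a₀ := h1.dvd_of_dvd_mul_right (by rw [h₀]; exact Dvd.intro b rfl)
  have e2 : a₀ ∣ a := h2.dvd_of_dvd_mul_right (by rw [← h₀]; exact Dvd.intro b₀ rfl)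
  exact Nat.dvd_antisymm e1 e2

/-- A solution with even positive `x` in the cell's ℕ-currency: `x = m`, `m` even, `m² = d·k² + 1`. [bookkeeping] -/
theorem pell_natWitness_of_even_x {d : ℕ} (a : Solution₁ (d : ℤ)) (hx : Even a.x) (hpos : 0 < a.x) :
    ∃ m k : ℕ, Even m ∧ m ^ 2 = d * k ^ 2 + 1 ∧ a.x = m := by
  refine ⟨a.x.natAbs, a.y.natAbs, Int.natAbs_even.2 hx, ?_, by rw [Int.natCast_natAbs, abs_of_pos hpos]⟩
  have h1 : ((a.x.natAbs ^ 2 : ℕ) : ℤ) = ((d * a.y.natAbs ^ 2 + 1 : ℕ) : ℤ) := by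
    push_cast
    rw [sq_abs, sq_abs, a.prop_x]
    ring
  exact_mod_cast h1

/-- **THE TYPE IS AN INVARIANT.** For odd `d`, two YES-certificates `b·v² = a·u² + 2`, `b'·v'² = a'·u'² + 2` (`a·b = a'·b' = d`) have `a = a'` and
`b = b'`: for each `d`, exactly one ordered factorisation `d = a·b` makes `b·x² − a·y² = 2` solvable when `ℚ(√-d)` is reached, none otherwise
(Legendre's theorem for the `±2` equations at `d ≡ 3 (mod 4)`). The type is that of the fundamental solution, `a = gcd(x₁ − 1, d)`. [bookkeeping] -/
theorem thetaSecant_plusTwoCertificate_unique {d a b u v a' b' u' v' : ℕ} (hd : Odd d) (hab : a * b = d)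
    (hc : b * v ^ 2 = a * u ^ 2 + 2) (hab' : a' * b' = d) (hc' : b' * v' ^ 2 = a' * u' ^ 2 + 2) : a = a' ∧ b = b' := by
  -- the fundamental solution exists and has even `x` (`d ≡ 3 (mod 4)` from the first certificate)
  obtain ⟨m, k, hm, -, hmk⟩ := thetaSecant_reach_of_plusTwoCertificate hd hab hc
  have hd4 := (mod_four_eq_three_of_even_of_pell hm hmk).1
  obtain ⟨a₁, h⟩ := pell_exists_isFundamental_of_mod_four_eq_three hd4
  have hd' : Odd (d : ℤ) := (Int.odd_coe_nat d).2 hd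
  have hx₁ : Even a₁.x := (thetaSecant_reach_iff_even_fundamental_x hd h).1 ⟨m, k, hm, hmk⟩
  -- its own YES-certificate `(a₀, b₀, u₀, v₀)` in ℕ
  obtain ⟨m₁, k₁, hm₁, hmk₁, hxm₁⟩ := pell_natWitness_of_even_x a₁ hx₁ (by linarith [h.1])
  obtain ⟨a₀, b₀, u₀, v₀, hab₀, hc₀, hm₁eq⟩ := thetaSecant_plusTwoCertificate_of_reach hm₁ hmk₁
  have hab₀z : (a₀ : ℤ) * b₀ = d := by exact_mod_cast hab₀
  have hx₁z : a₁.x = (a₀ : ℤ) * (u₀ : ℤ) ^ 2 + 1 := by rw [hxm₁, hm₁eq]; push_cast; ring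
  have hc₀z : (b₀ : ℤ) * (v₀ : ℤ) ^ 2 - a₀ * (u₀ : ℤ) ^ 2 = 2 := by
    have : ((b₀ * v₀ ^ 2 : ℕ) : ℤ) = ((a₀ * u₀ ^ 2 + 2 : ℕ) : ℤ) := by exact_mod_cast hc₀
    push_cast at this; linarith
  -- every YES-certificate of `d` has the reference type `a₀`
  have key : ∀ {a b u v : ℕ}, a * b = d → b * v ^ 2 = a * u ^ 2 + 2 → a = a₀ := by
    intro a b u v hab hc
    obtain ⟨hu, -⟩ := plusTwoCertificate_odd hd hab hc
    have hab_odd : Odd (a * b) := by rw [hab]; exact hd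
    have ha : Odd a := (Nat.odd_mul.1 hab_odd).1
    have hw : (a * u ^ 2 + 1) ^ 2 = d * (u * v) ^ 2 + 1 := by rw [← hab]; exact plusTwoCertificate_sq hc
    obtain ⟨h1, h2⟩ := pell_type_dvd_of_even_x hd' h hab₀z hx₁z hc₀z (Solution₁.mk _ _ (pell_prop_of_nat hw))
      (by rw [Solution₁.x_mk]; exact (Int.even_coe_nat _).2 ((ha.mul hu.pow).add_one))
      (by rw [Solution₁.x_mk]; exact_mod_cast Nat.succ_pos _)
    rw [Solution₁.x_mk] at h1 h2
    rw [show ((a * u ^ 2 + 1 : ℕ) : ℤ) - 1 = ((a * u ^ 2 : ℕ) : ℤ) by push_cast; ring] at h1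
    rw [show ((a * u ^ 2 + 1 : ℕ) : ℤ) + 1 = ((a * u ^ 2 + 2 : ℕ) : ℤ) by push_cast; ring] at h2
    exact plusTwoType_eq_of_dvd (ha.mul hu.pow) hc (by rw [hab₀, hab]) (Int.natCast_dvd_natCast.1 h1) (Int.natCast_dvd_natCast.1 h2)
  have e1 : a = a₀ := key hab hc
  have e2 : a' = a₀ := key hab' hc'
  refine ⟨e1.trans e2.symm, ?_⟩
  have ha0 : 0 < a := Nat.pos_of_ne_zero (by rintro rfl; rw [zero_mul] at hab; have := Nat.odd_iff.1 (hab ▸ hd); omega)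
  exact Nat.eq_of_mul_eq_mul_left ha0 (by rw [hab, ← hab', e1, e2])

/-! ## §3 Primes: the type is read off `p mod 8` -/

/-- **Prime type law.** For an odd prime `p`, a YES-certificate `b·v² = a·u² + 2`, `a·b = p` has type `(1, p)` — then `u² ≡ -2 (mod p)` — or
`(p, 1)` — then `v² ≡ 2 (mod p)`; reach forces `p ≡ 3 (mod 4)`, and the quadratic characters of `-2`, `2` (Mathlib `ZMod.exists_sq_eq_neg_two_iff`,
`ZMod.exists_sq_eq_two_iff`) leave exactly: type `(1, p)` with `p ≡ 3 (mod 8)`, or type `(p, 1)` with `p ≡ 7 (mod 8)`. (`p = 2` is excluded: it has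
the certificate `2·1² = 1·0² + 2`.) [bookkeeping] -/
theorem pell_plusTwo_prime_type {p a b u v : ℕ} (hp : p.Prime) (hp2 : p ≠ 2) (hab : a * b = p) (hcert : b * v ^ 2 = a * u ^ 2 + 2) :
    (a = 1 ∧ b = p ∧ p % 8 = 3) ∨ (a = p ∧ b = 1 ∧ p % 8 = 7) := by
  haveI := Fact.mk hp
  have hodd : Odd p := hp.odd_of_ne_two hp2
  obtain ⟨m, k, hm, -, hmk⟩ := thetaSecant_reach_of_plusTwoCertificate hodd hab hcert
  have hp4 : p % 4 = 3 := (mod_four_eq_three_of_even_of_pell hm hmk).1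
  rcases (Nat.dvd_prime hp).1 ⟨b, hab.symm⟩ with ha1 | hap
  · -- type `(1, p)`: `p·v² = u² + 2`, so `u² ≡ -2 (mod p)`
    subst ha1
    have hb : b = p := by simpa using hab
    rw [hb] at hcert
    refine Or.inl ⟨rfl, hb, ?_⟩
    have hsq : IsSquare (-2 : ZMod p) := by
      refine ⟨(u : ZMod p), ?_⟩
      have hz : ((p * v ^ 2 : ℕ) : ZMod p) = ((1 * u ^ 2 + 2 : ℕ) : ZMod p) := by exact_mod_cast congrArg (Nat.cast : ℕ → ZMod p) hcert
      push_cast at hz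
      rw [ZMod.natCast_self, zero_mul] at hz
      linear_combination hz
    have := (ZMod.exists_sq_eq_neg_two_iff hp2).1 hsq
    omega
  · -- type `(p, 1)`: `v² = p·u² + 2`, so `v² ≡ 2 (mod p)`
    rw [hap] at hcert hab
    have hb : b = 1 := Nat.eq_of_mul_eq_mul_left hp.pos (by rw [hab, mul_one])
    rw [hb] at hcert
    refine Or.inr ⟨hap, hb, ?_⟩
    have hsq : IsSquare (2 : ZMod p) := by
      refine ⟨(v : ZMod p), ?_⟩
      have hz : ((1 * v ^ 2 : ℕ) : ZMod p) = ((p * u ^ 2 + 2 : ℕ) : ZMod p) := by exact_mod_cast congrArg (Nat.cast : ℕ → ZMod p) hcert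
      push_cast at hz
      rw [ZMod.natCast_self, zero_mul, zero_add] at hz
      linear_combination -hz
    have := (ZMod.exists_sq_eq_two_iff hp2).1 hsq
    omega

/-- **Among primes `p ≡ 3 (mod 4)`: `v² − p·u² = 2` is solvable iff `p ≡ 7 (mod 8)`** (classical). ⟸ with NO datum: `p` is reached (predecessor
`thetaSecant_reaches_prime`), the witness descends to a YES-certificate (§1), whose type is `(p, 1)` by `pell_plusTwo_prime_type`; ⟹: a solution is
a YES-certificate of type `(p, 1)`. [bookkeeping] -/
theorem pell_plusTwo_solvable_iff_seven_mod_eight {p : ℕ} (hp : p.Prime) (hp4 : p % 4 = 3) :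
    (∃ u v : ℕ, v ^ 2 = p * u ^ 2 + 2) ↔ p % 8 = 7 := by
  have hp2 : p ≠ 2 := by rintro rfl; norm_num at hp4
  refine ⟨fun ⟨u, v, huv⟩ ↦ ?_, fun hp8 ↦ ?_⟩
  · rcases pell_plusTwo_prime_type (u := u) (v := v) hp hp2 (mul_one p) (by simpa using huv) with ⟨h1, -, -⟩ | ⟨-, -, h7⟩
    · subst h1; norm_num at hp4
    · exact h7
  · obtain ⟨m, k, hm, -, hmk⟩ := thetaSecant_reaches_prime hp hp4
    obtain ⟨a, b, u, v, hab, hcert, -⟩ := thetaSecant_plusTwoCertificate_of_reach hm hmk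
    rcases pell_plusTwo_prime_type hp hp2 hab hcert with ⟨-, -, h3⟩ | ⟨rfl, rfl, -⟩
    · omega
    · exact ⟨u, v, by simpa using hcert⟩

/-- **Among primes `p ≡ 3 (mod 4)`: `p·v² − u² = 2` (i.e. `u² − p·v² = -2`) is solvable iff `p ≡ 3 (mod 8)`** (classical; same route, type `(1, p)`).
[bookkeeping] -/
theorem pell_minusTwo_solvable_iff_three_mod_eight {p : ℕ} (hp : p.Prime) (hp4 : p % 4 = 3) :
    (∃ u v : ℕ, p * v ^ 2 = u ^ 2 + 2) ↔ p % 8 = 3 := by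
  have hp2 : p ≠ 2 := by rintro rfl; norm_num at hp4
  refine ⟨fun ⟨u, v, huv⟩ ↦ ?_, fun hp8 ↦ ?_⟩
  · rcases pell_plusTwo_prime_type (u := u) (v := v) hp hp2 (one_mul p) (by simpa using huv) with ⟨-, -, h3⟩ | ⟨h1, -, -⟩
    · exact h3
    · subst h1; norm_num at hp4
  · obtain ⟨m, k, hm, -, hmk⟩ := thetaSecant_reaches_prime hp hp4
    obtain ⟨a, b, u, v, hab, hcert, -⟩ := thetaSecant_plusTwoCertificate_of_reach hm hmk
    rcases pell_plusTwo_prime_type hp hp2 hab hcert with ⟨rfl, rfl, -⟩ | ⟨-, -, h7⟩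
    · exact ⟨u, v, by simpa using hcert⟩
    · omega

/-! ## §4 The `d < 400` table closed by certificates -/

/-- **YES-certificates `(d, a, b, u, v)`**, `d` odd, `a·b = d`, `b·v² = a·u² + 2`, for the 28 COMPOSITE YES rows of the table of squarefree `d ≡ 3 (mod 4)`,
`d < 400` (the 40 prime rows need none, `thetaSecant_reaches_prime`): `max(u, v) = 2709` at `d = 391` (Pell witness `(7338680, 371133)`), and
`d = 399 = 3·7·19`, the table's one «witness-only» row, is `(19, 21, 1, 1)`. Each `a = gcd(x₁ − 1, d)` (`p8/x5/plus_two_certs.py`). [bookkeeping] -/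
theorem thetaSecant_yesCertificate_table :
    ∀ t ∈ ([(15,3,5,1,1), (35,5,7,1,1), (51,1,51,7,1), (87,3,29,3,1), (91,13,7,11,15), (115,5,23,15,7), (119,119,1,1,11), (123,1,123,11,1),
      (143,11,13,1,1), (159,3,53,21,5), (187,1,187,41,3), (195,13,15,1,1), (215,43,5,1,3), (219,73,3,1,5), (231,3,77,5,1), (235,5,47,3,1),
      (247,19,13,67,81), (255,15,17,1,1), (267,1,267,49,3), (287,287,1,1,17), (291,1,291,17,1), (303,3,101,29,5), (319,11,29,1083,667),
      (323,17,19,1,1), (335,67,5,3,11), (339,1,339,313,17), (391,391,1,137,2709), (399,19,21,1,1)] : List (ℕ × ℕ × ℕ × ℕ × ℕ)),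
      t.1 % 2 = 1 ∧ t.2.1 * t.2.2.1 = t.1 ∧ t.2.2.1 * t.2.2.2.2 ^ 2 = t.2.1 * t.2.2.2.1 ^ 2 + 2 := by
  decide

/-- **The composite YES rows `d < 400` by certificate**: for each of the 28 rows some EVEN `m` and ODD `k` satisfy `m² = d·k² + 1` — `ℚ(√-d)` is
reached —, read off the row's YES-certificate by `thetaSecant_reach_of_plusTwoCertificate` (no Pell witness in the kernel). [bookkeeping] -/
theorem thetaSecant_yesList_400_by_certificate :
    ∀ t ∈ ([(15,3,5,1,1), (35,5,7,1,1), (51,1,51,7,1), (87,3,29,3,1), (91,13,7,11,15), (115,5,23,15,7), (119,119,1,1,11), (123,1,123,11,1),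
      (143,11,13,1,1), (159,3,53,21,5), (187,1,187,41,3), (195,13,15,1,1), (215,43,5,1,3), (219,73,3,1,5), (231,3,77,5,1), (235,5,47,3,1),
      (247,19,13,67,81), (255,15,17,1,1), (267,1,267,49,3), (287,287,1,1,17), (291,1,291,17,1), (303,3,101,29,5), (319,11,29,1083,667),
      (323,17,19,1,1), (335,67,5,3,11), (339,1,339,313,17), (391,391,1,137,2709), (399,19,21,1,1)] : List (ℕ × ℕ × ℕ × ℕ × ℕ)),
      ∃ m k : ℕ, Even m ∧ Odd k ∧ m ^ 2 = t.1 * k ^ 2 + 1 := by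
  intro t ht
  obtain ⟨hodd, hab, hcert⟩ := thetaSecant_yesCertificate_table t ht
  exact thetaSecant_reach_of_plusTwoCertificate (Nat.odd_iff.2 hodd) hab hcert

/-- **`d = 399 = 3·7·19` by certificate** (the one row of `p8/REACH-TABLE-400-p8g4.md` where the local criteria of the sequel files are silent —
`MethodInstanceG6ThetaSecantReachQuartic.lean` `…local_criterion_silent_at_399` —, so far decided by the Pell witness `(20, 1)` only): the
YES-certificate `21·1² − 19·1² = 2` reaches `ℚ(√-399)`, and by §2 `(19, 21)` is the ONLY type of `399` (e.g. `57·v² − 7·u² = 2` and `133·v² − 3·u² = 2`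
are unsolvable although no single prime of `399` obstructs the latter). [bookkeeping] -/
theorem thetaSecant_reaches_399_by_certificate :
    (∃ m k : ℕ, Even m ∧ Odd k ∧ m ^ 2 = 399 * k ^ 2 + 1) ∧
      ∀ a b u v : ℕ, a * b = 399 → b * v ^ 2 = a * u ^ 2 + 2 → a = 19 ∧ b = 21 :=
  ⟨thetaSecant_reach_of_plusTwoCertificate (a := 19) (b := 21) (u := 1) (v := 1) (Nat.odd_iff.2 rfl) rfl rfl,
    fun _ _ _ _ hab hc ↦ (thetaSecant_plusTwoCertificate_unique (a := 19) (b := 21) (u := 1) (v := 1) (Nat.odd_iff.2 rfl) rfl rfl hab hc).imp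
      Eq.symm Eq.symm⟩

end PellYesDescent

/-! ## Audit: nothing is decided here
KERNEL: §1 the `+2` descent both ways (even `m` ⟺ YES-certificate) and Legendre's dichotomy `+1` xor `+2` for odd non-square `d`; §2 uniqueness of
the type `(a, b)`; §3 the prime type law mod 8 and the solvability of `v² − p·u² = 2` (`p ≡ 7 (mod 8)`), `p·v² − u² = 2` (`p ≡ 3 (mod 8)`) with no
datum; §4 28 YES-certificates closing the `d < 400` table (`d = 399` included). BY VALUE: the 28 certificate rows. NOT decided: anything about Weil
classes, semiregularity or the census verdict (candidates 0; deciding rows «NO-in-families-tried»); which `ℚ(√-d)` are reached beyond the rows and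
primes shown still needs a certificate or the fundamental parity per `d`.
-/

end Summit.Ventures.HSemireg

end
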